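import Summits.CriticalPhenomena.PercolationContinuityZ3.Theorems.PercNearOneGluingNoHeavyLowerTailSahiTangentCylinderFourFrozen
import Literature.Combinatorics.Sahi2008.FKGCumulation

/-!
# `NoHeavyLowerTail` (crux stmt-CriticalPhenomena-4575), Sahi programme: **THE ORDER-4 CONTRACTION INEQUALITY FOR CYLINDER PAIRS ON EVERY CUBE —
# part 4: the statement for `bernoulliWeight`** — `s · E₄^{μ}(cylinder tops) ≤ E₄^{B_s ⊗ μ}(F)` for every product measure, every `s ∈ [0,1]`

Support file (Sahi cell, seat `prim-sahi-p1`, generation 49; `--supports stmt-CriticalPhenomena-4575`).  Pure proofs, no definitions, no `sorry`,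
standard axioms.  Parts 1–3 (`…SahiTangentCylinderFourPoly`, `…SahiTangentCylinderFourPairs`, `…SahiTangentCylinderFourFrozen`) prove `Δ₄(s) = D4cyl ≥ 0` given Sahi's `C₄` for the four
top cylinders; here that hypothesis is discharged by the tree's `sahiE_bernoulliWeight_ind_nonneg_offTwo` (Blinovsky/Sahi: `E_n ≥ 0` for cylinder
events under product weights) and `D4cyl` is identified with `E₄^{B_s ⊗ μ}(F) − s·E₄^{μ}(tops)` through `sahiE_four` and the layer splitting `ex_coin`.

THE RESULT (`sahiE_four_coin_cylinders_ge`).  `ι` finite, `q : ι → [0,1]`, `μ = bernoulliWeight q` (the product measure on `Set ι`), `s ∈ [0,1]`,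
cylinder pairs `t_l ⊆ b_l` (`l < 4`), `C(A) = {ω | A ⊆ ω}`, `F_l(ε,ω) = (ε ? 1_{C(t_l)} ω : 1_{C(b_l)} ω)`:
`s · E₄^{μ}(1_{C(t_0)},…,1_{C(t_3)}) ≤ E₄^{B_s⊗μ}(F_0,…,F_3)` — i.e. `s ↦ E₄^{B_s⊗μ}(F)/s` is non-increasing: the ORDER-4 contraction /
tangent inequality (memo FROM-prim-sahi-p2-gen32-TANGENT, Conjecture T at order 4) holds for cylinder pairs on every cube, extending the order-3 theorem
`sahiE_three_coin_cylinders_ge` (gen 48) and, for cylinder pairs, the chain theorem `SahiTangent.sahiE_coin_chain_ge` (gen 47).  The general all-orders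
statement reduces the same way to the vertex inequalities `Σ_π c_π(1 − j_K(π))∏X_B ≥ 0` (memo FROM-prim-sahi-p1-gen49-PRINCIPAL-BOTTOM-TANGENT §A2);
order 4 is what is proved here.  Nothing is asserted about Sahi's `C_n`, Kahn's conjecture or the increasing star. [this work]
-/

namespace Summit.CriticalPhenomena.PercolationContinuityZ3.Theorems.SahiTangentCyl

open Finset Literature.Probability.LatticeModels Literature.Combinatorics.Sahi2008
open Literature.Probability.Percolation.DecisionTree (ind ind_of_mem ind_of_not_mem)
open scoped BigOperators

noncomputable section

variable {ι : Type*} [DecidableEq ι] [Fintype ι]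

omit [Fintype ι] in
/-- Products of cylinder indicators are cylinder indicators of unions (two sets). [folklore] -/
theorem ind_cyl_mul₂ (A B : Finset ι) :
    (fun ω : Set ι => ind {ω : Set ι | (A : Set ι) ⊆ ω} ω * ind {ω : Set ι | (B : Set ι) ⊆ ω} ω)
      = ind {ω : Set ι | ((A ∪ B : Finset ι) : Set ι) ⊆ ω} := by
  funext ω
  by_cases hA : (A : Set ι) ⊆ ω <;> by_cases hB : (B : Set ι) ⊆ ω <;>
    simp [ind_of_mem, ind_of_not_mem, hA, hB, coe_union, Set.union_subset_iff]

omit [Fintype ι] in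
/-- Three sets. [folklore] -/
theorem ind_cyl_mul₃ (A B D : Finset ι) :
    (fun ω : Set ι => ind {ω : Set ι | (A : Set ι) ⊆ ω} ω * ind {ω : Set ι | (B : Set ι) ⊆ ω} ω * ind {ω : Set ι | (D : Set ι) ⊆ ω} ω)
      = ind {ω : Set ι | ((A ∪ B ∪ D : Finset ι) : Set ι) ⊆ ω} := by
  funext ω
  by_cases hA : (A : Set ι) ⊆ ω <;> by_cases hB : (B : Set ι) ⊆ ω <;> by_cases hD : (D : Set ι) ⊆ ω <;>
    simp [ind_of_mem, ind_of_not_mem, hA, hB, hD, coe_union, Set.union_subset_iff]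

omit [Fintype ι] in
/-- Four sets. [folklore] -/
theorem ind_cyl_mul₄ (A B D G : Finset ι) :
    (fun ω : Set ι => ind {ω : Set ι | (A : Set ι) ⊆ ω} ω * ind {ω : Set ι | (B : Set ι) ⊆ ω} ω * ind {ω : Set ι | (D : Set ι) ⊆ ω} ω
        * ind {ω : Set ι | (G : Set ι) ⊆ ω} ω)
      = ind {ω : Set ι | ((A ∪ B ∪ D ∪ G : Finset ι) : Set ι) ⊆ ω} := by
  funext ω
  by_cases hA : (A : Set ι) ⊆ ω <;> by_cases hB : (B : Set ι) ⊆ ω <;> by_cases hD : (D : Set ι) ⊆ ω <;> by_cases hG : (G : Set ι) ⊆ ω <;>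
    simp [ind_of_mem, ind_of_not_mem, hA, hB, hD, hG, coe_union, Set.union_subset_iff]

/-- `E_μ(1_{C(A)}·1_{C(B)}·1_{C(D)}·1_{C(G)}) = ∏_{e ∈ A ∪ B ∪ D ∪ G} p_e` (product form, four sets). [this work] -/
theorem ex_ind_cyl₄ (q : ι → unitInterval) (A B D G : Finset ι) :
    ex (bernoulliWeight q) (ind {ω : Set ι | (A : Set ι) ⊆ ω} * ind {ω : Set ι | (B : Set ι) ⊆ ω} * ind {ω : Set ι | (D : Set ι) ⊆ ω}
        * ind {ω : Set ι | (G : Set ι) ⊆ ω})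
      = cylMass (fun e => (q e : ℝ)) (A ∪ B ∪ D ∪ G) := by
  have h : ind {ω : Set ι | (A : Set ι) ⊆ ω} * ind {ω : Set ι | (B : Set ι) ⊆ ω} * ind {ω : Set ι | (D : Set ι) ⊆ ω}
      * ind {ω : Set ι | (G : Set ι) ⊆ ω} = ind {ω : Set ι | ((A ∪ B ∪ D ∪ G : Finset ι) : Set ι) ⊆ ω} := by
    funext ω
    simp only [Pi.mul_apply]
    by_cases hA : (A : Set ι) ⊆ ω <;> by_cases hB : (B : Set ι) ⊆ ω <;> by_cases hD : (D : Set ι) ⊆ ω <;> by_cases hG : (G : Set ι) ⊆ ω <;>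
      simp [ind_of_mem, ind_of_not_mem, hA, hB, hD, hG, coe_union, Set.union_subset_iff]
  rw [h, ex_ind_cyl]

omit [DecidableEq ι] in
/-- Eta form of `ex_ind_cyl`. [this work] -/
theorem ex_ind_cyl' (q : ι → unitInterval) (A : Finset ι) :
    ex (bernoulliWeight q) (fun ω => ind {ω : Set ι | (A : Set ι) ⊆ ω} ω) = cylMass (fun e => (q e : ℝ)) A :=
  ex_ind_cyl q A

omit [DecidableEq ι] in
/-- The coin-product expectation splits over the two layers. [this work] -/
theorem ex_coin (μ : Set ι → ℝ) (s : ℝ) (G : Bool × Set ι → ℝ) :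
    ex (fun z : Bool × Set ι => if z.1 then s * μ z.2 else (1 - s) * μ z.2) G
      = s * ex μ (fun ω => G (true, ω)) + (1 - s) * ex μ (fun ω => G (false, ω)) := by
  simp only [ex, Fintype.sum_prod_type, Fintype.sum_bool, if_true, if_false, Bool.false_eq_true, Finset.mul_sum, mul_assoc]

/-- **THE ORDER-4 CONTRACTION INEQUALITY FOR CYLINDER PAIRS ON A CUBE.**  For the product measure `μ = bernoulliWeight q` on `Set ι`, a coin
`s ∈ [0,1]`, and cylinder pairs `t_l ⊆ b_l` (`l < 4`):
`s · E₄^{μ}(1_{C(t₀)}, 1_{C(t₁)}, 1_{C(t₂)}, 1_{C(t₃)}) ≤ E₄^{B_s⊗μ}(F₀, F₁, F₂, F₃)`, `F_l(ε, ω) = ε ? 1_{C(t_l)} ω : 1_{C(b_l)} ω`. [this work] -/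
theorem sahiE_four_coin_cylinders_ge (q : ι → unitInterval) {s : ℝ} (hs0 : 0 ≤ s) (hs1 : s ≤ 1) {t b : Fin 4 → Finset ι}
    (htb : ∀ l, t l ⊆ b l) :
    s * sahiE (bernoulliWeight q) 4 ![ind {ω : Set ι | (t 0 : Set ι) ⊆ ω}, ind {ω : Set ι | (t 1 : Set ι) ⊆ ω}, ind {ω : Set ι | (t 2 : Set ι) ⊆ ω}, ind {ω : Set ι | (t 3 : Set ι) ⊆ ω}] ≤
      sahiE (fun z : Bool × Set ι => if z.1 then s * bernoulliWeight q z.2 else (1 - s) * bernoulliWeight q z.2) 4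
        ![fun z => if z.1 then ind {ω : Set ι | (t 0 : Set ι) ⊆ ω} z.2 else ind {ω : Set ι | (b 0 : Set ι) ⊆ ω} z.2,
          fun z => if z.1 then ind {ω : Set ι | (t 1 : Set ι) ⊆ ω} z.2 else ind {ω : Set ι | (b 1 : Set ι) ⊆ ω} z.2,
          fun z => if z.1 then ind {ω : Set ι | (t 2 : Set ι) ⊆ ω} z.2 else ind {ω : Set ι | (b 2 : Set ι) ⊆ ω} z.2,
          fun z => if z.1 then ind {ω : Set ι | (t 3 : Set ι) ⊆ ω} z.2 else ind {ω : Set ι | (b 3 : Set ι) ⊆ ω} z.2] := by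
  have hq0 : ∀ e, 0 ≤ ((q e : ℝ)) := fun e => (q e).2.1
  have hq1 : ∀ e, ((q e : ℝ)) ≤ 1 := fun e => (q e).2.2
  -- `C₄` for the four top cylinders (Sahi / Blinovsky for cylinder events under product weights)
  have hE4' : 0 ≤ sahiE (bernoulliWeight q) 4 ![ind {ω : Set ι | (t 0 : Set ι) ⊆ ω}, ind {ω : Set ι | (t 1 : Set ι) ⊆ ω}, ind {ω : Set ι | (t 2 : Set ι) ⊆ ω}, ind {ω : Set ι | (t 3 : Set ι) ⊆ ω}] := by
    have h := sahiE_bernoulliWeight_ind_nonneg_offTwo q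
      ![{ω : Set ι | (t 0 : Set ι) ⊆ ω}, {ω : Set ι | (t 1 : Set ι) ⊆ ω}, {ω : Set ι | (t 2 : Set ι) ⊆ ω}, {ω : Set ι | (t 3 : Set ι) ⊆ ω}] ∅ (by simp)
      (fun i hi => absurd hi (by simp)) ![((t 0 : Finset ι) : Set ι), ((t 1 : Finset ι) : Set ι), ((t 2 : Finset ι) : Set ι), ((t 3 : Finset ι) : Set ι)]
      (fun i _ => by fin_cases i <;> rfl)
    convert h using 2
    funext i
    fin_cases i <;> rfl
  -- expand both fourth functionals into cylinder masses
  rw [sahiE_four] at hE4' ⊢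
  rw [sahiE_four]
  simp only [ex_ind_cyl, ex_ind_cyl₂, ex_ind_cyl₃, ex_ind_cyl₄] at hE4'
  simp only [ex_coin, Pi.mul_apply, if_true, if_false, Bool.false_eq_true, ind_cyl_mul₂, ind_cyl_mul₃, ind_cyl_mul₄, ex_ind_cyl',
    ex_ind_cyl₂, ex_ind_cyl₃, ex_ind_cyl₄]
  have key := D4cyl_nonneg (p := fun e => (q e : ℝ)) hq0 hq1 hs0 hs1 htb (by
    have h := hE4'
    linarith)
  unfold D4cyl at key
  linarith

end

end Summit.CriticalPhenomena.PercolationContinuityZ3.Theorems.SahiTangentCyl
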